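import Summits.CriticalPhenomena.SAWScalingLimit.Theorems.SAWChargeContinuationAnchorExcursionSphereReduction
import Summits.CriticalPhenomena.SAWScalingLimit.Theorems.SAWLoopFugacityFlowAvoidanceLimitRatioOscillationReduction
import Summits.CriticalPhenomena.SAWScalingLimit.Theorems.SAWLoopFugacityFlowAvoidanceLimitInteriorRatioLimitReduction

/-!
# `AnchorExcursion` (stmt-CriticalPhenomena-11196) from the two PRINTED inputs in the tree's vocabulary:
# the uniform boundary Harnack principle (UBHP) for the `Ω_δ`-walk — shared verbatim with crux 10649 —
# and the interior convergence (GC_W) of the window Green's function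

Route `SAWChargeContinuation` of `CriticalPhenomena/SAWScalingLimit`, support item `AnchorExcursion`;
third file of the reduction (after `…AnchorExcursionWindowDecomposition`, `…AnchorExcursionSphereReduction`).
The companion file reduced the item to (BHP_W) + (INT_W), the window-graph forms of the two lattice
inputs of the sibling crux `SAWLoopFugacityFlow.AvoidanceLimit` (stmt-CriticalPhenomena-10649, line
`symplectic-fermion-anchor`). That line has meanwhile reduced ITS forms to two hypotheses in the
tree's vocabulary (`…RatioOscillationReduction`, `…InteriorRatioLimitReduction`):

* (UBHP) — the UNIFORM DISCRETE BOUNDARY HARNACK PRINCIPLE for the edge-killed walk of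
  `Ω_δ = discreteDomainGraph D δ` at a marked prime end, multiplicative and division-free: for a
  Dobrushin domain `D`, `p = D.pt i`, `R > 0`, `η > 0` there is `r > 0` such that for all small `δ`
  any two nonnegative functions on the volume `Λ = meshDomainFinset D δ` that are `P`-harmonic
  (`P = ¼·adjMat Ω_δ Λ`) at every vertex within `R` of `p` satisfy `h₁(z) h₂(z') ≤ (1+η) h₁(z') h₂(z)`
  for all `z, z'` within `r` of `p` (Chelkak–Wan 2021 Lemma 3.7 / Cor. 3.8, vendored statement-only
  as `Literature.Probability.LatticeModels.ChelkakWan_uniformBoundaryHarnack` in its printed,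
  site-killed induced form; the transport to the edge-killed `Ω_δ` and to Euclidean balls at a prime
  end of a Jordan domain is what a proof of (UBHP) must supply). (UBHP) mentions NO sub-graph: it is
  the same hypothesis for the confined graph of crux 10649 and for the window graph of this item;
* (GC_W) — INTERIOR CONVERGENCE OF THE WINDOW GREEN'S FUNCTION: for some `c > 0`, for Jordan
  `D' ⊆ D`, conformal `ψ : ℍ → D'`, distinct `z*, y* ∈ D'`: `greenEntry W_δ Λ u v → c·G_ℍ(ψ⁻¹z*, ψ⁻¹y*)`
  as `(δu, δv) → (z*, y*)` (`G_ℍ(x,y) = log(|x − ȳ|/|x − y|)`) — the window twin of the sibling's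
  (GC) (which has `confinedGraph` for `W_δ`); Chelkak–Wan 2021 Prop. 3.2 / Cor. 3.3,
  Chelkak–Smirnov 2011 Thm. 3.9, transposed to the tree's edge-killed walks. At `D' = D` the window
  graph IS `Ω_δ` (`windowGraph_self_eq`), so (GC_W) contains the convergence of the denominator.

This file: `windowRatioOscillation_of_uniformBHP` — (UBHP) ⇒ (BHP_W) (port of the sibling's
`stub_ratioOscillation_of_uniformBHP`: the columns `G_K(·, w)` are `P_{Ω_δ}`-harmonic near a marked
point for `K = Ω_δ` and for `K = W_δ`, which have the same edges there, `windowGraph_adj_iff_of_dist_lt`);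
`windowInteriorRatioLimit_of_greenConvergence` — (GC_W) ⇒ (INT_W) (port of
`stub_interiorRatioLimit_of_greenConvergence`); and the closing composition
**`anchorExcursion_of_uniformBHP_of_greenConvergence : (UBHP) → (GC_W) → AnchorExcursion`**.
So items 11196 and 10649/S3 now wait on ONE common hypothesis (UBHP) plus the interior convergence of
their respective Green's functions ((GC_W) here, (GC) there).

Sources: [ChelkakWan2021] §3.1–3.2; [Chelkak2016] §2.2; [ChelkakSmirnov2011] Thm. 3.9; G. F. Lawler,
*Intersections of Random Walks* (1991) §1.5 [Lawler1991]. No definitions, no named facts.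
-/

noncomputable section

open scoped ENNReal Topology ComplexConjugate BigOperators Classical
open Filter Finset Literature.Probability.RandomPlanarGeometry Literature.Probability.LatticeModels
open Summit.CriticalPhenomena.SAWScalingLimit.Theses.SAWChargeContinuation
open Summit.CriticalPhenomena.SAWScalingLimit.Theorems.AvoidanceLimit.Anchor
open Summit.CriticalPhenomena.SAWScalingLimit.Theorems.AvoidanceLimit.Anchor.KilledGreen

namespace Summit.CriticalPhenomena.SAWScalingLimit.Theorems.AnchorExcursion

/-! ## (UBHP) ⇒ (BHP_W) -/

/-- **(UBHP) ⇒ (BHP_W): the oscillation of the window ratio `G_W/G_{Ω_δ}` over `B(a,r) × B(b,r)`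
vanishes with `r`, uniformly in small `δ`, given the uniform boundary Harnack principle for the
`Ω_δ`-walk at the two marked prime ends.** Port, for the window graph, of the sibling line's
`stub_ratioOscillation_of_uniformBHP` (crux 10649): the column functions `G_K(·, w)` are
`P_{Ω_δ}`-harmonic within `R = min(ε/2, |a − b|/4)` of a marked point for both `K = Ω_δ` and `K = W_δ`
(`transition_mulVec_greenEntry`; ball agreement and `windowGraph_adj_iff_of_dist_lt` for `δ ≤ ε/4`;
the pole `w` is near the other marked point), (UBHP) at `a` first forces `G_{Ω_δ}(z', y) > 0`, and the
chain `(z,y) → (z',y) → (z',y')` costs `η/2` twice (`abs_div_sub_div_le_of_mul_le`, `G_W ≤ G_{Ω_δ}`).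
[cite: ChelkakWan2021, Lemma 3.7 and Corollary 3.8 (§3.2)] -/
theorem windowRatioOscillation_of_uniformBHP
    (hBHP : ∀ (D : DobrushinDomain) (i : Fin 2) (R : ℝ), 0 < R → ∀ η : ℝ, 0 < η → ∃ r : ℝ, 0 < r ∧
      ∀ᶠ δ in 𝓝[>] (0 : ℝ), ∀ h₁ h₂ : ↥(meshDomainFinset D.carrier δ) → ℝ,
        (∀ x, 0 ≤ h₁ x) → (∀ x, 0 ≤ h₂ x) →
        (∀ x : ↥(meshDomainFinset D.carrier δ), dist (meshPoint δ x) (D.pt i) < R →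
          Matrix.mulVec ((4 : ℝ)⁻¹ • adjMat (discreteDomainGraph D.carrier δ)
            (meshDomainFinset D.carrier δ)) h₁ x = h₁ x) →
        (∀ x : ↥(meshDomainFinset D.carrier δ), dist (meshPoint δ x) (D.pt i) < R →
          Matrix.mulVec ((4 : ℝ)⁻¹ • adjMat (discreteDomainGraph D.carrier δ)
            (meshDomainFinset D.carrier δ)) h₂ x = h₂ x) →
        ∀ z z' : ↥(meshDomainFinset D.carrier δ), dist (meshPoint δ z) (D.pt i) < r →
          dist (meshPoint δ z') (D.pt i) < r → h₁ z * h₂ z' ≤ (1 + η) * (h₁ z' * h₂ z)) :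
    ∀ (D D' : DobrushinDomain), D'.carrier ⊆ D.carrier → D'.pt 0 = D.pt 0 → D'.pt 1 = D.pt 1 →
      (∃ ε : ℝ, 0 < ε ∧ D'.carrier ∩ Metric.ball (D.pt 0) ε = D.carrier ∩ Metric.ball (D.pt 0) ε ∧
        D'.carrier ∩ Metric.ball (D.pt 1) ε = D.carrier ∩ Metric.ball (D.pt 1) ε) →
      ∀ η : ℝ, 0 < η → ∃ r : ℝ, 0 < r ∧ ∀ᶠ δ in 𝓝[>] (0 : ℝ), ∀ z z' y y' : Site 2,
        dist (meshPoint δ z) (D.pt 0) < r → dist (meshPoint δ z') (D.pt 0) < r →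
        dist (meshPoint δ y) (D.pt 1) < r → dist (meshPoint δ y') (D.pt 1) < r →
        0 < greenEntry (discreteDomainGraph D.carrier δ) (meshDomainFinset D.carrier δ) z y →
        0 < greenEntry (discreteDomainGraph D.carrier δ) (meshDomainFinset D.carrier δ) z' y' →
        |greenEntry (SimpleGraph.fromRel fun x y => (discreteDomainGraph D.carrier δ).Adj x y ∧
                (meshGraph D'.carrier δ).Adj x y ∧ x ∈ meshVertices D'.carrier δ ∧
                y ∈ meshVertices D'.carrier δ) (meshDomainFinset D.carrier δ) z y /
              greenEntry (discreteDomainGraph D.carrier δ) (meshDomainFinset D.carrier δ) z y -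
            greenEntry (SimpleGraph.fromRel fun x y => (discreteDomainGraph D.carrier δ).Adj x y ∧
                (meshGraph D'.carrier δ).Adj x y ∧ x ∈ meshVertices D'.carrier δ ∧
                y ∈ meshVertices D'.carrier δ) (meshDomainFinset D.carrier δ) z' y' /
              greenEntry (discreteDomainGraph D.carrier δ) (meshDomainFinset D.carrier δ) z' y'| ≤ η := by
  intro D D' _hsub _h0 _h1 hball η hη
  obtain ⟨ε, hε, hb0, hb1⟩ := hball
  -- the radii
  have hab : 0 < dist (D.pt 0) (D.pt 1) :=
    dist_pos.2 fun h => absurd (D.pt_injective h) (by decide)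
  set R : ℝ := min (ε / 2) (dist (D.pt 0) (D.pt 1) / 4) with hR_def
  have hR : 0 < R := by positivity
  have hRε : R ≤ ε / 2 := min_le_left _ _
  have hRab : R ≤ dist (D.pt 0) (D.pt 1) / 4 := min_le_right _ _
  obtain ⟨ra, hra, hA⟩ := hBHP D 0 R hR (η / 2) (by positivity)
  obtain ⟨rb, hrb, hB⟩ := hBHP D 1 R hR (η / 2) (by positivity)
  set r : ℝ := min (min ra rb) R with hr_def
  have hr : 0 < r := by positivity
  have hrra : r ≤ ra := (min_le_left _ _).trans (min_le_left _ _)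
  have hrrb : r ≤ rb := (min_le_left _ _).trans (min_le_right _ _)
  have hrR : r ≤ R := min_le_right _ _
  refine ⟨r, hr, ?_⟩
  have hδ : ∀ᶠ δ in 𝓝[>] (0 : ℝ), δ ∈ Set.Ioo (0 : ℝ) (ε / 4) := Ioo_mem_nhdsGT (by positivity)
  filter_upwards [hA, hB, hδ] with δ hA' hB' hδ' z z' y y' hz hz' hy hy' hpos hpos'
  obtain ⟨hδ0, hδε⟩ := hδ'
  -- notation
  set H := discreteDomainGraph D.carrier δ with hH_def
  set Hc := (SimpleGraph.fromRel fun x y => (discreteDomainGraph D.carrier δ).Adj x y ∧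
                (meshGraph D'.carrier δ).Adj x y ∧ x ∈ meshVertices D'.carrier δ ∧
                y ∈ meshVertices D'.carrier δ) with hHc_def
  set Λ := meshDomainFinset D.carrier δ with hΛ_def
  have hH : H ≤ zdGraph 2 := (discreteDomainGraph_le_meshGraph _ δ).trans (meshGraph_le_zdGraph _ δ)
  have hHc : Hc ≤ H := windowGraph_le _ _ δ
  have hHcz : Hc ≤ zdGraph 2 := hHc.trans hH
  have hε2 : R + 2 * δ ≤ ε := by linarith
  -- the four points lie in the volume
  have hmem : z ∈ Λ ∧ y ∈ Λ := by
    by_contra h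
    exact hpos.ne' (greenEntry_of_not H h)
  have hmem' : z' ∈ Λ ∧ y' ∈ Λ := by
    by_contra h
    exact hpos'.ne' (greenEntry_of_not H h)
  -- the poles stay away from the other marked point
  have hfar : ∀ (w : Site 2) (i j : Fin 2), i ≠ j → dist (meshPoint δ w) (D.pt j) < r →
      ∀ x : Λ, dist (meshPoint δ x) (D.pt i) < R → (x : Site 2) ≠ w := by
    intro w i j hij hw x hx hxw
    have hij' : dist (D.pt i) (D.pt j) = dist (D.pt 0) (D.pt 1) := by
      fin_cases i <;> fin_cases j
      · exact absurd rfl hij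
      · rfl
      · exact dist_comm _ _
      · exact absurd rfl hij
    have h3 := dist_triangle (D.pt i) (meshPoint δ w) (D.pt j)
    rw [hij', dist_comm (D.pt i)] at h3
    rw [hxw] at hx
    linarith
  -- harmonicity of the column Green's functions near a marked point, for `H` and for `W`
  have harmH : ∀ (w : Site 2) (i j : Fin 2), i ≠ j → dist (meshPoint δ w) (D.pt j) < r →
      ∀ x : Λ, dist (meshPoint δ x) (D.pt i) < R →
        Matrix.mulVec ((4 : ℝ)⁻¹ • adjMat H Λ) (fun x' : Λ => greenEntry H Λ x' w) x =
          greenEntry H Λ x w :=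
    fun w i j hij hw x hx => transition_mulVec_greenEntry hH Λ w x (hfar w i j hij hw x hx)
  have hballi : ∀ i : Fin 2,
      D'.carrier ∩ Metric.ball (D.pt i) ε = D.carrier ∩ Metric.ball (D.pt i) ε := by
    intro i
    fin_cases i
    · exact hb0
    · exact hb1
  have harmHc : ∀ (w : Site 2) (i j : Fin 2), i ≠ j → dist (meshPoint δ w) (D.pt j) < r →
      ∀ x : Λ, dist (meshPoint δ x) (D.pt i) < R →
        Matrix.mulVec ((4 : ℝ)⁻¹ • adjMat H Λ) (fun x' : Λ => greenEntry Hc Λ x' w) x =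
          greenEntry Hc Λ x w := by
    intro w i j hij hw x hx
    rw [← transition_mulVec_congr (K₁ := Hc) (fun x' : Λ => greenEntry Hc Λ x' w)
      (fun x' => windowGraph_adj_iff_of_dist_lt hδ0 hε2 (hballi i) hx)]
    exact transition_mulVec_greenEntry hHcz Λ w x (hfar w i j hij hw x hx)
  have h01 : (0 : Fin 2) ≠ 1 := by decide
  have h10 : (1 : Fin 2) ≠ 0 := by decide
  -- nonnegativity and domination
  have hnnH : ∀ (w : Site 2) (x : Λ), 0 ≤ greenEntry H Λ x w := fun w x => greenEntry_nonneg hH Λ x w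
  have hnnHc : ∀ (w : Site 2) (x : Λ), 0 ≤ greenEntry Hc Λ x w :=
    fun w x => greenEntry_nonneg hHcz Λ x w
  have hle : ∀ (v w : Site 2), greenEntry Hc Λ v w ≤ greenEntry H Λ v w :=
    fun v w => greenEntry_window_le D.carrier D'.carrier δ Λ v w
  -- Step 1: (UBHP) at `a` for `(G_H(·,y), G_H(·,y'))` forces `G_H(z', y) > 0`
  have hzra : dist (meshPoint δ z) (D.pt 0) < ra := lt_of_lt_of_le hz hrra
  have hz'ra : dist (meshPoint δ z') (D.pt 0) < ra := lt_of_lt_of_le hz' hrra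
  have hyrb : dist (meshPoint δ y) (D.pt 1) < rb := lt_of_lt_of_le hy hrrb
  have hy'rb : dist (meshPoint δ y') (D.pt 1) < rb := lt_of_lt_of_le hy' hrrb
  have s1 := hA' (fun x : Λ => greenEntry H Λ x y) (fun x : Λ => greenEntry H Λ x y') (hnnH y)
    (hnnH y') (harmH y 0 1 h01 hy) (harmH y' 0 1 h01 hy') ⟨z, hmem.1⟩ ⟨z', hmem'.1⟩ hzra hz'ra
  have hpos1 : 0 < greenEntry H Λ z' y := by
    have hprod : 0 < greenEntry H Λ z y * greenEntry H Λ z' y' := mul_pos hpos hpos'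
    rcases (greenEntry_nonneg hH Λ z' y).eq_or_lt with h | h
    · simp only [← h, zero_mul, mul_zero] at s1
      exact absurd s1 (not_le.2 hprod)
    · exact h
  -- Step 2: (UBHP) at `a` for `(G_W(·,y), G_H(·,y))`, at `(z, z')` and at `(z', z)`
  have s2 := hA' (fun x : Λ => greenEntry Hc Λ x y) (fun x : Λ => greenEntry H Λ x y) (hnnHc y)
    (hnnH y) (harmHc y 0 1 h01 hy) (harmH y 0 1 h01 hy) ⟨z, hmem.1⟩ ⟨z', hmem'.1⟩ hzra hz'ra
  have s2' := hA' (fun x : Λ => greenEntry Hc Λ x y) (fun x : Λ => greenEntry H Λ x y) (hnnHc y)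
    (hnnH y) (harmHc y 0 1 h01 hy) (harmH y 0 1 h01 hy) ⟨z', hmem'.1⟩ ⟨z, hmem.1⟩ hz'ra hzra
  have e1 : |greenEntry Hc Λ z y / greenEntry H Λ z y -
      greenEntry Hc Λ z' y / greenEntry H Λ z' y| ≤ η / 2 :=
    abs_div_sub_div_le_of_mul_le (by positivity) hpos hpos1 (greenEntry_nonneg hHcz Λ z y)
      (greenEntry_nonneg hHcz Λ z' y) (hle z y) (hle z' y) s2 s2'
  -- Step 3: (UBHP) at `b` for `(G_W(·,z'), G_H(·,z'))`, at `(y, y')` and at `(y', y)`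
  have s3 := hB' (fun x : Λ => greenEntry Hc Λ x z') (fun x : Λ => greenEntry H Λ x z') (hnnHc z')
    (hnnH z') (harmHc z' 1 0 h10 hz') (harmH z' 1 0 h10 hz') ⟨y, hmem.2⟩ ⟨y', hmem'.2⟩ hyrb hy'rb
  have s3' := hB' (fun x : Λ => greenEntry Hc Λ x z') (fun x : Λ => greenEntry H Λ x z') (hnnHc z')
    (hnnH z') (harmHc z' 1 0 h10 hz') (harmH z' 1 0 h10 hz') ⟨y', hmem'.2⟩ ⟨y, hmem.2⟩ hy'rb hyrb
  simp only [greenEntry_comm hHcz Λ _ z', greenEntry_comm hH Λ _ z'] at s3 s3'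
  have e2 : |greenEntry Hc Λ z' y / greenEntry H Λ z' y -
      greenEntry Hc Λ z' y' / greenEntry H Λ z' y'| ≤ η / 2 :=
    abs_div_sub_div_le_of_mul_le (by positivity) hpos1 hpos' (greenEntry_nonneg hHcz Λ z' y)
      (greenEntry_nonneg hHcz Λ z' y') (hle z' y) (hle z' y') s3 s3'
  -- conclude
  have t := abs_sub_le (greenEntry Hc Λ z y / greenEntry H Λ z y)
    (greenEntry Hc Λ z' y / greenEntry H Λ z' y) (greenEntry Hc Λ z' y' / greenEntry H Λ z' y')
  linarith

/-! ## (GC_W) ⇒ (INT_W) -/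

/-- **(GC_W) ⇒ (INT_W): the window ratio at interior reference points tends to the ratio of
continuum Green's functions, given the interior convergence of the window Green's function.**
Port of the sibling line's `stub_interiorRatioLimit_of_greenConvergence` (crux 10649): (GC_W) at
`D' = D`, `ψ = φ` is the convergence of the denominator (`windowGraph_self_eq`); (GC_W) at `(D, D')`
with `ψ = φ ∘ Φ_A⁻¹` (`Φ.symm.trans (φ.restrHull D')`) that of the numerator;
`G_D(z*,y*) = G_ℍ(φ⁻¹z*, φ⁻¹y*) > 0` (`log_norm_sub_conj_div_pos`); then the algebra of a ratio of
two approximations (`abs_div_sub_div_le_of_abs_sub_le`). The constant `c` (`= 2/π` in print) cancels.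
[cite: ChelkakWan2021, Proposition 3.2 and Corollary 3.3 (§3.1)] -/
theorem windowInteriorRatioLimit_of_greenConvergence
    (hGC : ∃ c : ℝ, 0 < c ∧ ∀ (D D' : JordanDomain), D'.carrier ⊆ D.carrier →
      ∀ (ψ : ConformalEquiv UpperHalfPlane.upperHalfPlaneSet D'.carrier),
      ∀ zs ys : ℂ, zs ∈ D'.carrier → ys ∈ D'.carrier → zs ≠ ys →
      ∀ η : ℝ, 0 < η → ∃ s : ℝ, 0 < s ∧ ∀ᶠ δ in 𝓝[>] (0 : ℝ), ∀ u v : Site 2,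
        dist (meshPoint δ u) zs < s → dist (meshPoint δ v) ys < s →
        |greenEntry (SimpleGraph.fromRel fun x y => (discreteDomainGraph D.carrier δ).Adj x y ∧
                (meshGraph D'.carrier δ).Adj x y ∧ x ∈ meshVertices D'.carrier δ ∧
                y ∈ meshVertices D'.carrier δ) (meshDomainFinset D.carrier δ) u v -
          c * Real.log (‖ψ.symm zs - (starRingEnd ℂ) (ψ.symm ys)‖ / ‖ψ.symm zs - ψ.symm ys‖)| ≤ η) :
    ∀ (D D' : DobrushinDomain), D'.carrier ⊆ D.carrier → D'.pt 0 = D.pt 0 → D'.pt 1 = D.pt 1 →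
      (∃ ε : ℝ, 0 < ε ∧ D'.carrier ∩ Metric.ball (D.pt 0) ε = D.carrier ∩ Metric.ball (D.pt 0) ε ∧
        D'.carrier ∩ Metric.ball (D.pt 1) ε = D.carrier ∩ Metric.ball (D.pt 1) ε) →
      ∀ (φ : ConformalEquiv UpperHalfPlane.upperHalfPlaneSet D.carrier), D.IsChordalUniformizing φ →
      ∀ (A : Set ℂ), A = closure (UpperHalfPlane.upperHalfPlaneSet \
        {z | z ∈ UpperHalfPlane.upperHalfPlaneSet ∧ φ z ∈ D'.carrier}) →
      ∀ (Φ : ConformalEquiv (UpperHalfPlane.upperHalfPlaneSet \ A) UpperHalfPlane.upperHalfPlaneSet),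
        IsRestrictionMap A Φ →
      ∀ zs ys : ℂ, zs ∈ D'.carrier → ys ∈ D'.carrier → zs ≠ ys →
      ∀ η : ℝ, 0 < η → ∃ s : ℝ, 0 < s ∧ ∀ᶠ δ in 𝓝[>] (0 : ℝ), ∀ u v : Site 2,
        dist (meshPoint δ u) zs < s → dist (meshPoint δ v) ys < s →
        0 < greenEntry (discreteDomainGraph D.carrier δ) (meshDomainFinset D.carrier δ) u v →
        |greenEntry (SimpleGraph.fromRel fun x y => (discreteDomainGraph D.carrier δ).Adj x y ∧
                (meshGraph D'.carrier δ).Adj x y ∧ x ∈ meshVertices D'.carrier δ ∧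
                y ∈ meshVertices D'.carrier δ) (meshDomainFinset D.carrier δ) u v /
              greenEntry (discreteDomainGraph D.carrier δ) (meshDomainFinset D.carrier δ) u v -
            Real.log (‖Φ (φ.symm zs) - (starRingEnd ℂ) (Φ (φ.symm ys))‖ / ‖Φ (φ.symm zs) - Φ (φ.symm ys)‖) /
              Real.log (‖φ.symm zs - (starRingEnd ℂ) (φ.symm ys)‖ / ‖φ.symm zs - φ.symm ys‖)| ≤ η := by
  obtain ⟨c, hc, hconv⟩ := hGC
  intro D D' hsub _h0 _h1 _hball φ _hφ A hA Φ _hΦ zs ys hzs hys hne η hη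
  have hA' : A = φ.pullbackHull D' := hA
  subst hA'
  -- the two conformal images of the reference points
  have hu : φ.symm zs ∈ UpperHalfPlane.upperHalfPlaneSet := φ.symm_mapsTo (hsub hzs)
  have hv : φ.symm ys ∈ UpperHalfPlane.upperHalfPlaneSet := φ.symm_mapsTo (hsub hys)
  have hne' : φ.symm zs ≠ φ.symm ys := fun h => hne (φ.symm.injOn (hsub hzs) (hsub hys) h)
  have hLpos : 0 < Real.log (‖φ.symm zs - (starRingEnd ℂ) (φ.symm ys)‖ / ‖φ.symm zs - φ.symm ys‖) :=
    log_norm_sub_conj_div_pos hne' hu hv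
  -- the limits `a = c·G_D(z*,y*) > 0` and `b = c·G_{D'}(z*,y*)`
  set L := Real.log (‖φ.symm zs - (starRingEnd ℂ) (φ.symm ys)‖ / ‖φ.symm zs - φ.symm ys‖) with hL
  set L' := Real.log (‖Φ (φ.symm zs) - (starRingEnd ℂ) (Φ (φ.symm ys))‖ /
    ‖Φ (φ.symm zs) - Φ (φ.symm ys)‖) with hL'
  set a := c * L with ha_def
  set b := c * L' with hb_def
  have ha : 0 < a := mul_pos hc hLpos
  have hab : 0 < a + |b| := by positivity
  set e := min (a / 2) (η * a ^ 2 / (2 * (a + |b|))) with he_def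
  have he : 0 < e := lt_min (half_pos ha) (by positivity)
  -- (GC_W) at `D' = D`, `ψ = φ`: the denominator
  obtain ⟨s₁, hs₁, hev₁⟩ := hconv D.toJordanDomain D.toJordanDomain subset_rfl φ zs ys (hsub hzs)
    (hsub hys) hne e he
  -- (GC_W) at `(D, D')`, `ψ = φ ∘ Φ⁻¹`: the numerator
  obtain ⟨s₂, hs₂, hev₂⟩ := hconv D.toJordanDomain D'.toJordanDomain hsub
    (Φ.symm.trans (φ.restrHull D' hsub)) zs ys hzs hys hne e he
  refine ⟨min s₁ s₂, lt_min hs₁ hs₂, ?_⟩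
  filter_upwards [hev₁, hev₂] with δ h₁ h₂ u v hdu hdv _hpos
  have h₁' := h₁ u v (lt_of_lt_of_le hdu (min_le_left _ _)) (lt_of_lt_of_le hdv (min_le_left _ _))
  have h₂' : |greenEntry (SimpleGraph.fromRel fun x y => (discreteDomainGraph D.carrier δ).Adj x y ∧
                (meshGraph D'.carrier δ).Adj x y ∧ x ∈ meshVertices D'.carrier δ ∧
                y ∈ meshVertices D'.carrier δ) (meshDomainFinset D.carrier δ) u v - b| ≤ e :=
    h₂ u v (lt_of_lt_of_le hdu (min_le_right _ _)) (lt_of_lt_of_le hdv (min_le_right _ _))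
  have hself := windowGraph_self_eq D.carrier δ
  rw [hself] at h₁'
  have key := abs_div_sub_div_le_of_abs_sub_le ha h₁' h₂' (min_le_left _ _)
  -- `b/a = L'/L` and `2e(a + |b|)/a² ≤ η`
  have hba : b / a = L' / L := by
    rw [hb_def, ha_def, mul_div_mul_left _ _ hc.ne']
  have hbound : 2 * e * (a + |b|) / a ^ 2 ≤ η := by
    rw [div_le_iff₀ (pow_pos ha 2)]
    have h1 : e ≤ η * a ^ 2 / (2 * (a + |b|)) := min_le_right _ _
    have h2 : e * (2 * (a + |b|)) ≤ η * a ^ 2 := (le_div_iff₀ (by positivity)).1 h1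
    linarith
  rw [hba] at key
  exact key.trans hbound

/-! ## The closing composition -/

/-- **`(UBHP) → (GC_W) → AnchorExcursion`.** The item follows from the uniform discrete boundary
Harnack principle for the `Ω_δ`-walk at the marked prime ends — the SAME hypothesis (verbatim) as the
sibling crux 10649's `stub_ratioOscillation_of_uniformBHP` — and the interior convergence of the
window Green's function (the window twin of that line's (GC)); composition of
`windowRatioOscillation_of_uniformBHP`, `windowInteriorRatioLimit_of_greenConvergence` and
`anchorExcursion_of_oscillation_of_interiorLimit`. Both hypotheses are printed theorems
(Chelkak–Wan 2021 Cor. 3.8; Prop. 3.2 / Cor. 3.3) up to the transport from site-killed induced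
discrete domains to the tree's edge-killed walks; neither is in the tree.
[cite: ChelkakWan2021, Corollary 3.8 (§3.2); Corollary 3.3 (§3.1)] -/
theorem anchorExcursion_of_uniformBHP_of_greenConvergence
    (hBHP : ∀ (D : DobrushinDomain) (i : Fin 2) (R : ℝ), 0 < R → ∀ η : ℝ, 0 < η → ∃ r : ℝ, 0 < r ∧
      ∀ᶠ δ in 𝓝[>] (0 : ℝ), ∀ h₁ h₂ : ↥(meshDomainFinset D.carrier δ) → ℝ,
        (∀ x, 0 ≤ h₁ x) → (∀ x, 0 ≤ h₂ x) →
        (∀ x : ↥(meshDomainFinset D.carrier δ), dist (meshPoint δ x) (D.pt i) < R →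
          Matrix.mulVec ((4 : ℝ)⁻¹ • adjMat (discreteDomainGraph D.carrier δ)
            (meshDomainFinset D.carrier δ)) h₁ x = h₁ x) →
        (∀ x : ↥(meshDomainFinset D.carrier δ), dist (meshPoint δ x) (D.pt i) < R →
          Matrix.mulVec ((4 : ℝ)⁻¹ • adjMat (discreteDomainGraph D.carrier δ)
            (meshDomainFinset D.carrier δ)) h₂ x = h₂ x) →
        ∀ z z' : ↥(meshDomainFinset D.carrier δ), dist (meshPoint δ z) (D.pt i) < r →
          dist (meshPoint δ z') (D.pt i) < r → h₁ z * h₂ z' ≤ (1 + η) * (h₁ z' * h₂ z))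
    (hGC : ∃ c : ℝ, 0 < c ∧ ∀ (D D' : JordanDomain), D'.carrier ⊆ D.carrier →
      ∀ (ψ : ConformalEquiv UpperHalfPlane.upperHalfPlaneSet D'.carrier),
      ∀ zs ys : ℂ, zs ∈ D'.carrier → ys ∈ D'.carrier → zs ≠ ys →
      ∀ η : ℝ, 0 < η → ∃ s : ℝ, 0 < s ∧ ∀ᶠ δ in 𝓝[>] (0 : ℝ), ∀ u v : Site 2,
        dist (meshPoint δ u) zs < s → dist (meshPoint δ v) ys < s →
        |greenEntry (SimpleGraph.fromRel fun x y => (discreteDomainGraph D.carrier δ).Adj x y ∧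
                (meshGraph D'.carrier δ).Adj x y ∧ x ∈ meshVertices D'.carrier δ ∧
                y ∈ meshVertices D'.carrier δ) (meshDomainFinset D.carrier δ) u v -
          c * Real.log (‖ψ.symm zs - (starRingEnd ℂ) (ψ.symm ys)‖ / ‖ψ.symm zs - ψ.symm ys‖)| ≤ η) :
    AnchorExcursion :=
  anchorExcursion_of_oscillation_of_interiorLimit (windowRatioOscillation_of_uniformBHP hBHP)
    (windowInteriorRatioLimit_of_greenConvergence hGC)

end Summit.CriticalPhenomena.SAWScalingLimit.Theorems.AnchorExcursion

end
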